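import Summits.BirchSwinnertonDyer.Rank1Residual.Supersingular.X7VisibilityRecordsC1
import Summits.BirchSwinnertonDyer.Rank1Residual.Supersingular.RankOneRem13NoCertificate
import Summits.BirchSwinnertonDyer.Rank1Residual.Supersingular.IntModelMinimalityKrausTwoMore
import Literature.NumberTheory.EllipticCurves.Fisher2012.HesseFamilyFiveIndClosedForms
import Literature.NumberTheory.EllipticCurves.Rank1Residual.Typed.X7
import Summits.BirchSwinnertonDyer.Rank1Residual.Supersingular.X7VisibilityShapeFiveKinds
import Literature.NumberTheory.EllipticCurves.RationalPointInfiniteOrderCriteria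
import Summits.BirchSwinnertonDyer.Rank1Residual.Supersingular.RankZeroSurjCertificatesX7_14
import HarnessLib

/-!
# N5 (X7 ∧ r_an = 0, p ≥ 5) by VISIBILITY — per-pair `BSD(E,p)` from a `p`-congruent partner of positive rank, Wuthrich's upper bound,
# Cassels–Tate and the refined FIVE-kind count — cell `444048s1 @ 5` (x10b gen 16, visibility wave 2: partners BEYOND Cremona's range)

Cell `b2b-bsdres`, supersingular family, prover A = unit `b2b-bsdres-x10b` (gen 16), X7 joint pair A side.  Topic file;
namespace `Summit.BirchSwinnertonDyer.Rank1Residual.Supersingular`.  THEOREMS ONLY; no named fact, no definition, nothing booked; X7 stays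
CONSTRUCTION-SHAPED (mark of RESIDUAL-MAP §I N5 unchanged).  Shapes: `X7VisibilityShapeFiveKinds.lean` (five kinds, place `p` free by
Mazur–Rubin 2015, p322361/p325521), `X7VisibilityRecordsC1.lean` / `X6VisibilityTamDefectShape.lean` (three/four kinds, x10b gen 15).  Partner found by
Fisher's Hesse pencil `X_E(5)` (engine `kit/vis2`, x10b gen 16; jobs and logs in HOME/b2b-bsdres-x10b/gen16/).  The congruence: KERNEL (Fisher 2012/2013 Hesse certificate, `norm_num` on the tree's closed forms).

HONEST FRAMING (run/shared/lean/b2b/bsd-rank1-residual/, verbatim in every file): the goal of the cell is to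
DELETE the COMBINATION-SHAPED residual classes of the Birch–Swinnerton-Dyer formula for ALL analytic-rank `≤ 1`
elliptic curves over `ℚ` — "full BSD formula for every rank `≤ 1` curve in class `C`" assembled STRICTLY from
published theorems — so that the rank-`≤ 1` remainder becomes exactly the CONSTRUCTION-SHAPED classes, which are
TYPED (missing-input `Prop`s), NOT attempted.  This is not "finishing BSD".

References: Mazur–Rubin 2015 [MazurRubin2015SelmerCompanions]; Fisher 2016 Thm. 4.4 [Fisher2016Visualizing7]; Fisher 2012 Thm. 13.2 / 2013
[Fisher2012Hessian]; Fisher 2014 (X_E(7)) [folklore pointer: LMS JCM 17]; Cremona–Mazur 2000 §3 [CremonaMazur2000]; Wuthrich 2014 Prop. 21 [Wuthrich2014];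
Silverman AEC VII.3.4, VII.5.1, X.4.14 [SilvermanAEC2009]; Kraus 1989 [Kraus1989]; Cremona's tables [Cremona2006]; HOME/b2b-bsdres-x10b/X7-KURIHARA.md (gen 16 section).
-/

set_option autoImplicit false

noncomputable section

open scoped Classical

open WeierstrassCurve Literature.NumberTheory.EllipticCurves
  Literature.NumberTheory.EllipticCurves.Rank1Residual
  Literature.NumberTheory.EllipticCurves.Rank1Residual.Typed
  Literature.NumberTheory.EllipticCurves.Rank1Residual.X11RankOneCertificates
  Literature.NumberTheory.EllipticCurves.Wuthrich2014
  Literature.NumberTheory.EllipticCurves.Fisher2016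
  Literature.NumberTheory.EllipticCurves.Fisher2012 Literature.NumberTheory.EllipticCurves.MazurRubin2015
  Summit.BirchSwinnertonDyer.BirchSwinnertonDyer.Rank1Residual.IntModel
  Summit.BirchSwinnertonDyer.Rank1Residual.X11b
open NumberField IsDedekindDomain Rat.HeightOneSpectrum

namespace Summit.BirchSwinnertonDyer.Rank1Residual.Supersingular

/-! ### `444048s1 @ 5` ← `F444048s1_5` (conductor `5772624`, OUTSIDE every table; target: N5 cell, `ord_5 ∏c = 0`, `ord_5 #Ш_an = 2`) -/

/-- `444048s1` (Cremona's minimal model) is an elliptic curve. [cite: Cremona2006, Table 1 (Cremona label 444048s1)] -/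
theorem isElliptic_c444048s1 : (⟨0, -1, 0, -191014928, -1016503763520⟩ : WeierstrassCurve ℚ).IsElliptic :=
  isElliptic_of_discOf_ne_zero 0 (-1) 0 (-191014928) (-1016503763520) (by decide +kernel)

/-- `444048s1` is globally minimal: complete factorisation `|Δ| = 2^22·3^1·11^6·29^7` kernel-checked and Kraus' criterion prime by prime
(additive-p3's `isGloballyMinimal_of_krausCriterion₃_factored`, `|Δ| ≥ 512¹²`). [cite: SilvermanAEC2009, VII.1 Remark 1.1] [cite: Kraus1989, Prop. 1 and Prop. 2] -/
theorem isGloballyMinimal_c444048s1 : (⟨0, -1, 0, -191014928, -1016503763520⟩ : WeierstrassCurve ℚ).IsGloballyMinimal :=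
  isGloballyMinimal_of_krausCriterion₃_factored 0 (-1) 0 (-191014928) (-1016503763520)
    [(2, 22), (3, 1), (11, 6), (29, 7)] (by decide +kernel)
    (by intro qe hqe; simp only [List.mem_cons, List.not_mem_nil, or_false] at hqe
        rcases hqe with rfl | rfl | rfl | rfl <;> norm_num)
    (by set_option synthInstance.maxSize 2000 in decide +kernel)

/-- `F444048s1_5` (minimal model, conductor `5772624`, OUTSIDE every table) is an elliptic curve. [folklore] -/
theorem isElliptic_cF444048s1_5 : (⟨0, -1, 0, 44397792, 205996711680⟩ : WeierstrassCurve ℚ).IsElliptic :=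
  isElliptic_of_discOf_ne_zero 0 (-1) 0 44397792 205996711680 (by decide +kernel)

/-- `F444048s1_5` is globally minimal: complete factorisation `|Δ| = 2^22·3^4·11^1·13^5·29^7` kernel-checked and Kraus' criterion prime by prime
(additive-p3's `isGloballyMinimal_of_krausCriterion₃_factored`, `|Δ| ≥ 512¹²`). [cite: SilvermanAEC2009, VII.1 Remark 1.1] [cite: Kraus1989, Prop. 1 and Prop. 2] -/
theorem isGloballyMinimal_cF444048s1_5 : (⟨0, -1, 0, 44397792, 205996711680⟩ : WeierstrassCurve ℚ).IsGloballyMinimal :=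
  isGloballyMinimal_of_krausCriterion₃_factored 0 (-1) 0 44397792 205996711680
    [(2, 22), (3, 4), (11, 1), (13, 5), (29, 7)] (by decide +kernel)
    (by intro qe hqe; simp only [List.mem_cons, List.not_mem_nil, or_false] at hqe
        rcases hqe with rfl | rfl | rfl | rfl | rfl <;> norm_num)
    (by set_option synthInstance.maxSize 2000 in decide +kernel)

/-- `#Ẽ(𝔽_5) = 6` for `444048s1` (`a_5 = 0`: good SUPERSINGULAR at `5`; kernel count). [folklore] -/
theorem card_c444048s1_5 :
    Nat.card (((⟨0, -1, 0, -191014928, -1016503763520⟩ : WeierstrassCurve ℤ).map (Int.castRingHom (ZMod 5))).toAffine.Point) = 6 :=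
  haveI : Fact (Nat.Prime 5) := ⟨by norm_num⟩
  natCard_point_eq_of_countPoints 0 (-1) 0 (-191014928) (-1016503763520) 5 (by norm_num) (by decide +kernel) (by decide +kernel)

/-- `1 ≤ rank F444048s1_5(ℚ)` in the KERNEL (kind `NL`): the rational point `(409840/529, 5971234560/12167)` lies on the (globally minimal) model and
`23 ∣ den x`, so it has infinite order (Lutz–Nagell / AEC VII.3.4, tree `one_le_mordellWeilRank_of_dvd_den`). [cite: SilvermanAEC2009, VII.3.4 and Thm. VIII.6.7] -/
theorem one_le_rank_cF444048s1_5 : 1 ≤ (⟨0, -1, 0, 44397792, 205996711680⟩ : WeierstrassCurve ℚ).mordellWeilRank := by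
  haveI := isElliptic_cF444048s1_5
  haveI := isGloballyMinimal_cF444048s1_5
  haveI : Fact (Nat.Prime 23) := ⟨by norm_num⟩
  exact one_le_mordellWeilRank_of_dvd_den _ 23 (by norm_num) (x := (409840 : ℚ) / 529) (y := (5971234560 : ℚ) / 12167)
    (WeierstrassCurve.Affine.equation_iff_nonsingular.mp ((WeierstrassCurve.Affine.equation_iff _ _).mpr (by norm_num)))
    (by decide +kernel)

/-- **`BSD(E,5)` for `444048s1`** (N5 cell without a per-pair theorem of record: class X7, good supersingular at `5` (`#Ẽ(𝔽_5) = 6`), `r_an = 0`, `#Ш_an` of `5`-adic order 2) from PUBLISHED theorems — Cassels–Tate (`hCT`), Wuthrich 2014 Prop. 21 (`hW`), GZK (`hGZK`), modularity (`hmod`), Tate uniformisation (`hU`, `hU2`), Fisher 2016 Thm. 4.4 (`hF44`), Mazur–Rubin 2015 (`hMR`) —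
and a VISIBLE element of `Ш(E)[5]` explained by the `5`-CONGRUENT curve `F` of conductor `5772624` (OUTSIDE every table; found by Fisher's Hesse pencil `X_E(5)`; `a_ℓ(E) ≡ a_ℓ(F) (mod 5)` at every good `ℓ ≤ 3000`).
rank F ≥ 2: points [[-1296, 382464], [3258, 620658]] independent in F(ℚ)/5F(ℚ) by reduction functionals at [43, 67] (engine); IN THE KERNEL `1 ≤ rank F` from the point `(409840/529, 5971234560/12167)` (`23 ∣ den x`, Lutz–Nagell); Places (E/F): `2` additive/additive: kind (i) (`#F(ℚ_v)[p] = 1`, displayed); `3` multiplicative/multiplicative: kind (i) (`#F(ℚ_v)[p] = 1`, displayed); `5` good/good: kind (v) (both GOOD at p — KERNEL; Mazur–Rubin 2015: the place p is FREE); `11` multiplicative/multiplicative: kind (i) (`#F(ℚ_v)[p] = 1`, displayed); `13` good/multiplicative: kind (i) (`#F(ℚ_v)[p] = 1`, displayed); `29` additive/additive: kind (i) (`#F(ℚ_v)[p] = 1`, displayed).  KERNEL: minimality (Kraus), `ClassX7 E 5`, `surj(5)` (B's `surj_x7r0_444048s1_5`), good reduction of both curves off `S = {2, 3, 5, 11,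 13, 29}` (discriminant supports), `5 ∤ #E(ℚ)`, both curves GOOD at `5` (kind (v)), `1 ≤ rank F`.
Displayed binders: `θ` (`hθ`), the local data `h_v` at the displayed places, `r_an = 0`, `ord_5 #Ш_an ≤ 2`.  Cremona data of the target: `N = 444048`, `ord_5 ∏c = 0`, `ord_5 #Ш_an = 2`.  Per pair (an OFFER for referee A); NOT a class theorem; nothing booked.
[cite: Wuthrich2014, Prop. 21 (p. 400)] [cite: MazurRubin2015SelmerCompanions, Thm. 3.1 (iv)(b) and §6 Case 5] [cite: CremonaMazur2000, §3 and Table 1]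
[cite: SilvermanATAEC1994, Ch. V Thm. 3.1, Lemma 5.2, Thm. 5.3, Cor. 5.4] [cite: SilvermanAEC2009, VII.5 Prop. 5.1 and Thm. X.4.14] [cite: Cremona2006, Table 1 (Cremona label 444048s1)] -/
theorem bsdp_x7r0vis5_444048s1_5_of_congr
    (hCT : exists_casselsTate_pairing (K := ℚ)) (hW : sha_dvd_analyticSha)
    (hGZK : rank_eq_analyticRank_of_analyticRank_le_one) (hmod : hasEntireLFunction_rat)
    (hU : Silverman1994_thmV53_tateUniformisation.{0})
    (hU2 : Silverman1994_thmV53_corV54_tateUniformisation.{0})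
    (hF44 : thm44_selmerLocalKer_iff_of_nonsplit_good) (hMR : selmerLocalKer_iff_of_goodReduction_above)
    {W F : WeierstrassCurve ℚ} [W.IsElliptic] [W.IsGloballyMinimal] [F.IsElliptic] [F.IsGloballyMinimal]
    (hWeq : W = ⟨0, -1, 0, -191014928, -1016503763520⟩) (hFeq : F = ⟨0, -1, 0, 44397792, 205996711680⟩)
    (hr0 : W.analyticRank = 0) {q : ℚ} (hq : shaAn W = (q : ℂ)) (hv : padicValRat 5 q ≤ 2)
    (θ : geomTorsion F (5 : ℤ) ≃+ geomTorsion W (5 : ℤ))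
    (hθ : ∀ (σ : Field.absoluteGaloisGroup ℚ) (P : geomTorsion F (5 : ℤ)), θ (σ • P) = σ • θ P)
    (h2 : ∀ w : HeightOneSpectrum (𝓞 ℚ), (primesEquiv w : ℕ) = 2 →
      Nat.card (nsmulAddMonoidHom 5 : (F.baseChange (w.adicCompletion ℚ)).toAffine.Point →+ _).ker = 1)
    (h3 : ∀ w : HeightOneSpectrum (𝓞 ℚ), (primesEquiv w : ℕ) = 3 →
      Nat.card (nsmulAddMonoidHom 5 : (F.baseChange (w.adicCompletion ℚ)).toAffine.Point →+ _).ker = 1)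
    (h11 : ∀ w : HeightOneSpectrum (𝓞 ℚ), (primesEquiv w : ℕ) = 11 →
      Nat.card (nsmulAddMonoidHom 5 : (F.baseChange (w.adicCompletion ℚ)).toAffine.Point →+ _).ker = 1)
    (h13 : ∀ w : HeightOneSpectrum (𝓞 ℚ), (primesEquiv w : ℕ) = 13 →
      Nat.card (nsmulAddMonoidHom 5 : (F.baseChange (w.adicCompletion ℚ)).toAffine.Point →+ _).ker = 1)
    (h29 : ∀ w : HeightOneSpectrum (𝓞 ℚ), (primesEquiv w : ℕ) = 29 →
      Nat.card (nsmulAddMonoidHom 5 : (F.baseChange (w.adicCompletion ℚ)).toAffine.Point →+ _).ker = 1)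
    : BSDp W 5 := by
  haveI : Fact (Nat.Prime 5) := ⟨by norm_num⟩
  have hrank : 1 ≤ F.mordellWeilRank := by rw [hFeq]; exact one_le_rank_cF444048s1_5
  have hIW : integralModelInt W = ⟨0, -1, 0, -191014928, -1016503763520⟩ :=
    integralModelInt_eq_of_map_eq _ (by rw [hWeq]; ext <;> simp [WeierstrassCurve.map])
  have hIF : integralModelInt F = ⟨0, -1, 0, 44397792, 205996711680⟩ :=
    integralModelInt_eq_of_map_eq _ (by rw [hFeq]; ext <;> simp [WeierstrassCurve.map])
  have hX : ClassX7 W 5 :=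
    classX7_of_intModel 5 hIW (by decide +kernel) card_c444048s1_5 (by decide) 2 (by norm_num) (by decide +kernel)
      (by decide +kernel)
  have hs : Surj W 5 := (by rw [hWeq]; exact surj_x7r0_444048s1_5)
  set L : List ℕ := [2, 3, 5, 11, 13, 29] with hL
  have hLp : ∀ q ∈ L, q.Prime := by
    intro q hq
    simp only [hL, List.mem_cons, List.mem_nil_iff, or_false] at hq
    rcases hq with rfl | rfl | rfl | rfl | rfl | rfl <;> norm_num
  have hΔE : ∀ q : ℕ, q.Prime → (q : ℤ) ∣ (⟨0, -1, 0, -191014928, -1016503763520⟩ : WeierstrassCurve ℤ).Δ → q ∈ L :=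
    forall_mem_of_natAbs_eq_prod_pow L [22, 1, 0, 6, 0, 7] hLp (by decide +kernel)
  have hΔF : ∀ q : ℕ, q.Prime → (q : ℤ) ∣ (⟨0, -1, 0, 44397792, 205996711680⟩ : WeierstrassCurve ℤ).Δ → q ∈ L :=
    forall_mem_of_natAbs_eq_prod_pow L [22, 4, 0, 1, 5, 7] hLp (by decide +kernel)
  set e := primesEquiv (R := 𝓞 ℚ) with he
  set S : Finset (HeightOneSpectrum (𝓞 ℚ)) :=
    (L.filterMap fun r ↦ if h : r.Prime then some (e.symm ⟨r, h⟩) else none).toFinset with hSdef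
  have hmemS : ∀ w : HeightOneSpectrum (𝓞 ℚ), w ∈ S ↔ (e w : ℕ) ∈ L := by
    intro w
    rw [hSdef, List.mem_toFinset, List.mem_filterMap]
    constructor
    · rintro ⟨r, hr, hrw⟩
      by_cases hrp : r.Prime
      · rw [dif_pos hrp, Option.some.injEq] at hrw
        rw [← hrw, Equiv.apply_symm_apply]
        exact hr
      · rw [dif_neg hrp] at hrw
        exact absurd hrw (by simp)
    · intro hw
      refine ⟨(e w : ℕ), hw, ?_⟩
      rw [dif_pos (e w).2]
      simp
  set T : Finset (HeightOneSpectrum (𝓞 ℚ)) := ∅ with hTdef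
  have hTS : T ⊆ S := by rw [hTdef]; exact Finset.empty_subset _
  have hS : ∀ w : HeightOneSpectrum (𝓞 ℚ), w ∉ S →
      W.HasGoodReductionAt w ∧ F.HasGoodReductionAt w ∧ ((5 : ℕ) : 𝓞 ℚ) ∉ w.asIdeal := by
    intro w hwS
    have hwL : (e w : ℕ) ∉ L := fun h ↦ hwS ((hmemS w).mpr h)
    have hq : (e w : ℕ).Prime := (e w).2
    refine ⟨?_, ?_, natCast_not_mem_of_primesEquiv_ne w Fact.out fun h ↦ hwL ?_⟩
    · rw [hWeq]; exact hasGoodReductionAt_mk_of_primesEquiv _ _ _ _ _ w rfl fun h ↦ hwL (hΔE _ hq h)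
    · rw [hFeq]; exact hasGoodReductionAt_mk_of_primesEquiv _ _ _ _ _ w rfl fun h ↦ hwL (hΔF _ hq h)
    · show (primesEquiv w : ℕ) ∈ L
      rw [h]; decide
  have hT : (∏ w ∈ T, Nat.card (nsmulAddMonoidHom 5 :
        (F.baseChange (w.adicCompletion ℚ)).toAffine.Point →+ _).ker *
        Nat.card (w.adicCompletionIntegers ℚ ⧸
          Ideal.span {((5 : ℕ) : w.adicCompletionIntegers ℚ)})) < 5 ^ F.mordellWeilRank := by
    rw [hTdef, Finset.prod_empty]
    calc (1 : ℕ) < 5 ^ 1 := by norm_num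
      _ ≤ 5 ^ F.mordellWeilRank := Nat.pow_le_pow_right (by norm_num) hrank
  have hplaces : ∀ w ∈ S, w ∉ T →
      (((5 : ℕ) : 𝓞 ℚ) ∉ w.asIdeal ∧ Nat.card (nsmulAddMonoidHom 5 :
          (F.baseChange (w.adicCompletion ℚ)).toAffine.Point →+ _).ker = 1) ∨
      (W.HasSplitMultiplicativeReductionAt w ∧ F.HasSplitMultiplicativeReductionAt w ∧
        Nat.card (nsmulAddMonoidHom 5 :
          (W.baseChange (w.adicCompletion ℚ)).toAffine.Point →+ _).ker ≤ 5) ∨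
      (W.HasMultiplicativeReductionAt w ∧ F.HasMultiplicativeReductionAt w ∧
        (∃ r : w.adicCompletion ℚ, algebraMap ℚ (w.adicCompletion ℚ) (-(W.c₄ / W.c₆)) =
          r ^ 2 * algebraMap ℚ (w.adicCompletion ℚ) (-(F.c₄ / F.c₆))) ∧
        (∀ ζ : w.adicCompletion ℚ, ζ ^ 5 = 1 → ζ = 1)) ∨
      ((W.HasMultiplicativeReductionAt w ∧ ¬ W.HasSplitMultiplicativeReductionAt w ∧
          F.HasGoodReductionAt w) ∨
        (W.HasGoodReductionAt w ∧ F.HasMultiplicativeReductionAt w ∧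
          ¬ F.HasSplitMultiplicativeReductionAt w)) ∨
      (((5 : ℕ) : 𝓞 ℚ) ∈ w.asIdeal ∧ W.HasGoodReductionAt w ∧ F.HasGoodReductionAt w) := by
    intro w hwS _hwT
    have hwL : (e w : ℕ) ∈ L := (hmemS w).mp hwS
    have hcases : (e w : ℕ) = 2 ∨ (e w : ℕ) = 3 ∨ (e w : ℕ) = 5 ∨ (e w : ℕ) = 11 ∨ (e w : ℕ) = 13 ∨ (e w : ℕ) = 29 := by
      simp only [hL, List.mem_cons, List.mem_nil_iff, or_false] at hwL
      omega
    rcases hcases with hw | hw | hw | hw | hw | hw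
    · -- 2: kind (i)
      exact Or.inl ⟨natCast_not_mem_of_primesEquiv_ne w Fact.out (by rw [hw]; decide), h2 w hw⟩
    · -- 3: kind (i)
      exact Or.inl ⟨natCast_not_mem_of_primesEquiv_ne w Fact.out (by rw [hw]; decide), h3 w hw⟩
    · -- 5 = p: kind (v) (Mazur–Rubin): both curves GOOD at p (kernel: p ∤ Δ on both integer models)
      refine Or.inr (Or.inr (Or.inr (Or.inr ⟨?_, ?_, ?_⟩)))
      · rw [← hw]; exact natCast_natGenerator_mem w
      · rw [hWeq]; exact hasGoodReductionAt_mk_of_primesEquiv _ _ _ _ _ w hw (by decide +kernel)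
      · rw [hFeq]; exact hasGoodReductionAt_mk_of_primesEquiv _ _ _ _ _ w hw (by decide +kernel)
    · -- 11: kind (i)
      exact Or.inl ⟨natCast_not_mem_of_primesEquiv_ne w Fact.out (by rw [hw]; decide), h11 w hw⟩
    · -- 13: kind (i)
      exact Or.inl ⟨natCast_not_mem_of_primesEquiv_ne w Fact.out (by rw [hw]; decide), h13 w hw⟩
    · -- 29: kind (i)
      exact Or.inl ⟨natCast_not_mem_of_primesEquiv_ne w Fact.out (by rw [hw]; decide), h29 w hw⟩
  exact X7RankZero.bsdp_of_casselsTate_of_congr_of_places₅_of_surj hCT hW hGZK hmod hU hU2 hF44 hMR W 5 (by norm_num) hX hs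
    hr0 hq hv F θ hθ S T hTS hS hT hplaces

/-- **`BSD(E,5)` for `444048s1` with the `5`-congruence PROVED in the kernel** (modulo the named fact Fisher 2012 Thm. 13.2 `hF13`): `F` is ℚ-isomorphic to the member `(λ : μ) = (-53476 : 1)` of Fisher's Hesse pencil `X_E(5)` of `E` — the two covariant identities with `u = 2585715944858240264699904` are checked by `norm_num` on the tree's closed forms; the engine located the point, the kernel re-verifies.  Remaining binders: those of `bsdp_x7r0vis5_444048s1_5_of_congr` minus `θ`, `hθ`.  Per pair; NOT a class theorem; nothing booked. [cite: Fisher2012Hessian, Thm. 13.2] [cite: Wuthrich2014, Prop. 21 (p. 400)] [cite: Cremona2006, Table 1 (Cremona label 444048s1)] -/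
theorem bsdp_x7r0vis5_444048s1_5
    (hCT : exists_casselsTate_pairing (K := ℚ)) (hW : sha_dvd_analyticSha)
    (hGZK : rank_eq_analyticRank_of_analyticRank_le_one) (hmod : hasEntireLFunction_rat)
    (hU : Silverman1994_thmV53_tateUniformisation.{0})
    (hU2 : Silverman1994_thmV53_corV54_tateUniformisation.{0})
    (hF44 : thm44_selmerLocalKer_iff_of_nonsplit_good) (hMR : selmerLocalKer_iff_of_goodReduction_above)
    (hF13 : thm132_fiveCongruent_hessePencil)
    {W F : WeierstrassCurve ℚ} [W.IsElliptic] [W.IsGloballyMinimal] [F.IsElliptic] [F.IsGloballyMinimal]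
    (hWeq : W = ⟨0, -1, 0, -191014928, -1016503763520⟩) (hFeq : F = ⟨0, -1, 0, 44397792, 205996711680⟩)
    (hr0 : W.analyticRank = 0) {q : ℚ} (hq : shaAn W = (q : ℂ)) (hv : padicValRat 5 q ≤ 2)
    (h2 : ∀ w : HeightOneSpectrum (𝓞 ℚ), (primesEquiv w : ℕ) = 2 →
      Nat.card (nsmulAddMonoidHom 5 : (F.baseChange (w.adicCompletion ℚ)).toAffine.Point →+ _).ker = 1)
    (h3 : ∀ w : HeightOneSpectrum (𝓞 ℚ), (primesEquiv w : ℕ) = 3 →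
      Nat.card (nsmulAddMonoidHom 5 : (F.baseChange (w.adicCompletion ℚ)).toAffine.Point →+ _).ker = 1)
    (h11 : ∀ w : HeightOneSpectrum (𝓞 ℚ), (primesEquiv w : ℕ) = 11 →
      Nat.card (nsmulAddMonoidHom 5 : (F.baseChange (w.adicCompletion ℚ)).toAffine.Point →+ _).ker = 1)
    (h13 : ∀ w : HeightOneSpectrum (𝓞 ℚ), (primesEquiv w : ℕ) = 13 →
      Nat.card (nsmulAddMonoidHom 5 : (F.baseChange (w.adicCompletion ℚ)).toAffine.Point →+ _).ker = 1)
    (h29 : ∀ w : HeightOneSpectrum (𝓞 ℚ), (primesEquiv w : ℕ) = 29 →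
      Nat.card (nsmulAddMonoidHom 5 : (F.baseChange (w.adicCompletion ℚ)).toAffine.Point →+ _).ker = 1)
    : BSDp W 5 := by
  have hc4 : W.c₄ = (9168716560 : ℚ) := by
    subst hWeq; norm_num [WeierstrassCurve.c₄, WeierstrassCurve.b₂, WeierstrassCurve.b₄]
  have hc6 : W.c₆ = (878314263980608 : ℚ) := by
    subst hWeq; norm_num [WeierstrassCurve.c₆, WeierstrassCurve.b₂, WeierstrassCurve.b₄, WeierstrassCurve.b₆]
  have hc4F : F.c₄ = (-2131094000 : ℚ) := by
    subst hFeq; norm_num [WeierstrassCurve.c₄, WeierstrassCurve.b₂, WeierstrassCurve.b₄]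
  have hc6F : F.c₆ = (-177993945455552 : ℚ) := by
    subst hFeq; norm_num [WeierstrassCurve.c₆, WeierstrassCurve.b₂, WeierstrassCurve.b₄, WeierstrassCurve.b₆]
  obtain ⟨θ, hθ⟩ := fiveCongruent_of_hesseCertificate hF13 W F (-53476 : ℚ) 1
    (2585715944858240264699904 : ℚ) (by norm_num)
    (by rw [hc4, hc6, hc4F, eval_hesseC4]; norm_num) (by rw [hc4, hc6, hc6F, eval_hesseC6]; norm_num)
  exact bsdp_x7r0vis5_444048s1_5_of_congr hCT hW hGZK hmod hU hU2 hF44 hMR hWeq hFeq hr0 hq hv θ hθ h2 h3 h11 h13 h29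

end Summit.BirchSwinnertonDyer.Rank1Residual.Supersingular

end
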